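import Literature.Probability.RandomPlanarGeometry.LatticeFlowLinePassage
import HarnessLib

/-!
# The canonically unwrapped centred window of the lattice flow-line functional (variant C″)

Definition file (request `defn-centredWindowAngleC`; consumer: the crux `HarmonicWindingPassageR` =
stmt-CriticalPhenomena-13996 of route CriticalPhenomena/SAWScalingLimit/SAWTiltedExplorer, which
inlines the three terms below by `let angC … let HC …`, so that provers can rewrite the item into
named form by `rfl`). Companion of `LatticeFlowLinePassage.lean` (the ANCHORED centred window
`centredWindowAngle`, variant C′) and of `LatticeFlowLineHarmonic.lean` (first-passage rule,
absorbed harmonic extension `triHitExtension`, path geometry `dartAngle`, `firstPassage`,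
`IsLeftOfDart`, `flowLineAbsorbing`), whose vocabulary it reuses.

## The object

For a face sequence `P : ℕ → HexVertex` (faces `f_0, f_1, …` of a honeycomb exploration path, dart
`i` = `f_i → f_{i+1}`, `c_j = hexCenter (P j)`) and a dart `i`, the CHORD over the `2m + 1` darts
centred at `i` is `c_{i+1+m} − c_{i−m}`, with raw direction `θ_m(i) = arg (c_{i+1+m} − c_{i−m})`
(`centredChordArg`; `θ_0(i) = arg (c_{i+1} − c_i)` is the direction of the dart itself). The
**canonically unwrapped centred-window angle** of half-width `h` is

  `Θ_h(i) = A_i + ∑_{m<h} pv (θ_{m+1}(i) − θ_m(i))`      (`centredWindowAngleC β P h i`),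

`A_i = dartAngle β P i` the unwrapped dart angle (gauge anchored on `β`), `pv` the principal value
in `(−π, π]` (`Real.Angle.toReal`): the chord direction is lifted to `ℝ` CONTINUOUSLY, growing the
window radius ring by ring from the dart itself (radius `0`, where the lift is `A_i`) and adding the
principal values of the increments. Whenever the true increments are `< π` in absolute value (the
case of simple honeycomb face paths) this is THE continuous lift started at `A_i`
(`centredWindowAngleC_eq_of_lift`), as opposed to the anchored rule
`Â_h(i) = A_i + pv (θ_h(i) − A_i)` of `centredWindowAngle`, which picks the representative of
`θ_h(i)` nearest to `A_i` and therefore jumps sheet as soon as the relative winding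
`Θ_h(i) − A_i` exceeds `π` (refuter evidence on stmt-CriticalPhenomena-14169: the law of the
lattice-vs-scale-`h` relative winding spreads like `(6/25) log h`, Duplantier–Binder).

The bank data `latticeFlowLineCentredDataC E β c g h n P` and the functional
`latticeFlowLineHarmonicCentredC E β c g h n P ζ` are then exactly those of the anchored variant
(`latticeFlowLineCentredData`, `latticeFlowLineHarmonicCentred`) with `Θ_h` in place of `Â_h`:
`β` on the two discrete arcs; a bank hexagon `u` first passed by the dart `i₀ = firstPassage P u`
carries `c (Θ − π/2)/(π/3) ∓ g` (`−` iff `u` is on the LEFT of that dart), `Θ = Θ_h(i₀)` once the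
forward half-window has been explored (`i₀ + h < n`) and the provisional adapted value `A_{i₀}`
before; the functional is the absorbed harmonic extension along `Ω_δ` of these data from the arcs
and the hexagons passed by the darts `< n` (Schramm–Sheffield's discrete harmonic extension).

LITERAL SHAPES. The bodies of the three definitions are, up to the names, the `let`-bound terms
`angC`, the data lambda and `HC` of the crux verbatim (binder order `E β c g h n P ζ`,
`Finset.range`, the index shapes `i + 2 + m`, `i - (m + 1)`, `i + 1 + m`, `i - m`, the
`if firstPassage P u + h < n` adaptedness switch), so that the crux unfolds to the named form by
`Iff.rfl`.

## What is proved (all folklore)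

`centredWindowAngleC_zero` (`Θ_0 = A`), `centredWindowAngleC_succ` (radial recursion),
`abs_centredWindowAngleC_succ_sub_le` (`≤ π` per ring), `abs_centredWindowAngleC_sub_dartAngle_le`
(`|Θ_h − A| ≤ h π`; NOT `≤ π`: the relative winding is unbounded in `h`), `coe_centredWindowAngleC`
(canonical sheet: `Θ_h ≡ A + θ_h − θ_0 (mod 2π)`), `centredWindowAngleC_eq_of_lift` (the pv-lift is
the continuous lift when the true increments are `< π`); for the data: values on the arcs,
provisional = first-passage datum (`…_of_le`), the difference from the first-passage data
(`…_sub`, bounded by `3 h |c|`), radius `0` = first-passage data, boundedness on the absorbing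
set; for the functional: boundary values, harmonicity off the absorbing set
(`isTriHarmonicExtension_…`), boundedness, radius `0` = first-passage functional, and the difference
from the first-passage functional as the absorbed extension of the window correction
(`latticeFlowLineHarmonicCentredC_sub`); ADAPTEDNESS: at time `n` the data (on the absorbing set)
and the functional only read the faces `P 0, …, P n` (`…_congr`), whence the functional stopped at
a prefix stopping rule is `𝓕_σ`-measurable (`isPrefixDetermined_latticeFlowLineHarmonicCentredC`).
No named fact is introduced.

## Junk values (documented)

`ℕ`-subtraction `i - m`, `i - (m + 1)` truncates the backward half-window at the start of the path
for darts `i < h` (a distorted datum on an initial stretch of `h` darts, i.e. of lattice length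
`h δ`); `firstPassage` junk (`0` for never-passed hexagons) is never read on the absorbing set;
`Complex.arg 0 = 0` for degenerate chords (closed sub-paths), which do not occur on simple paths.

## Not here

The geometric facts that on a simple honeycomb face path `A_i ≡ θ_0(i) (mod 2π)` and each radial
increment has true angle change `< π` (so that the hypotheses of `centredWindowAngleC_eq_of_lift`
are met), and the mirror/reversal covariance of `Θ`, are not proved here.

## References

* O. Schramm, S. Sheffield, *Harmonic explorer and its convergence to SLE₄*, Ann. Probab. 33 (2005)
  2127–2148 = arXiv:math/0310210, §3.1 "Notation and basic properties of HE" (the discrete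
  harmonic extension; Lemma 1: the martingale property of the HE functional). [SchrammSheffield2005]
* J. Miller, S. Sheffield, *Imaginary geometry I*, PTRF 164 (2016) = arXiv:1201.1496, Thm. 1.1,
  Fig. 1.10 (flow-line boundary values `∓λ' + χ · winding`). [MillerSheffield2016]
* B. Duplantier, I. Binder, Phys. Rev. Lett. 89 (2002) 264101 (harmonic-measure-weighted winding
  spread of conformally invariant curves). [DuplantierBinder2002]
-/

noncomputable section

open Finset

namespace Literature.Probability.RandomPlanarGeometry

open Literature.Probability.LatticeModels Literature.Probability.Percolation

/-! ### The canonically unwrapped centred-window angle -/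

/-- **Raw direction of the centred chord**: `θ_m(i) = arg (c_{i+1+m} − c_{i−m})`,
`c_j = hexCenter (P j)`, the principal-value direction of the displacement over the `2m + 1` darts
`i − m, …, i + m` centred at the dart `i` of the face sequence `P` (`θ_0(i)` is the direction of the
dart `i` itself; `ℕ`-subtraction truncates the window at the start of the path for `i < m`,
documented junk). [folklore] -/
def centredChordArg (P : ℕ → HexVertex) (m i : ℕ) : ℝ :=
  Complex.arg (hexCenter (P (i + 1 + m)) - hexCenter (P (i - m)))

/-- **The canonically unwrapped centred-window angle** (variant C″):
`Θ_h(i) = A_i + ∑_{m<h} pv (θ_{m+1}(i) − θ_m(i))`, `A_i = dartAngle β P i` the unwrapped dart angle,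
`θ_m(i) = arg (c_{i+1+m} − c_{i−m})` the raw direction of the chord over the `2m + 1` darts centred
at `i`, `pv` the principal value in `(−π, π]`: the chord direction over the window of half-width `h`,
lifted continuously by growing the radius ring by ring from the dart itself. The body is verbatim
the `let angC` term of the crux `HarmonicWindingPassageR` (index shapes `i + 2 + m`, `i - (m + 1)`,
`i + 1 + m`, `i - m`). [folklore] -/
def centredWindowAngleC (β : Site 2 → ℝ) (P : ℕ → HexVertex) (h i : ℕ) : ℝ :=
  dartAngle β P i +
    ∑ m ∈ Finset.range h,
      (((Complex.arg (hexCenter (P (i + 2 + m)) - hexCenter (P (i - (m + 1)))) -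
          Complex.arg (hexCenter (P (i + 1 + m)) - hexCenter (P (i - m))) : ℝ) : Real.Angle)).toReal

open scoped Classical in
/-- **Canonical centred-window bank data at time `n`** (variant C″, texture-free and ADAPTED): `β` on
the two discrete arcs; a bank hexagon `u` first passed by the dart `i₀ = firstPassage P u` carries
`c (Θ − π/2)/(π/3) ∓ g` (`−` iff `u` is on the LEFT of that dart, `IsLeftOfDart`), where `Θ` is the
canonically unwrapped centred-window angle `centredWindowAngleC β P h i₀` once the forward
half-window has been explored (`i₀ + h < n`) and the provisional value `A_{i₀} = dartAngle β P i₀`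
before. Exactly the shape of `latticeFlowLineCentredData` with `Θ` for `Â`; the route uses the
continuum constants `c = 1/3`, `g = 1`. [folklore] -/
def latticeFlowLineCentredDataC (E : DiscreteDobrushin) (β : Site 2 → ℝ) (c g : ℝ) (h n : ℕ)
    (P : ℕ → HexVertex) : Site 2 → ℝ := fun u =>
  if u ∈ E.triArcA ∪ E.triArcB then β u
  else c * (((if firstPassage P u + h < n then centredWindowAngleC β P h (firstPassage P u)
      else dartAngle β P (firstPassage P u)) - Real.pi / 2) / (Real.pi / 3)) +
    (if IsLeftOfDart P (firstPassage P u) u then -g else g)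

/-- **The canonical centred-window lattice flow-line harmonic functional** at time `n` (darts
`i < n` performed): the absorbed harmonic extension along `Ω_δ` (simple random walk on the
hexagons, absorbed on the arcs and on the hexagons passed so far, `flowLineAbsorbing`) of the
canonical centred-window data, evaluated at the hexagon `ζ` — Schramm–Sheffield's discrete
harmonic extension of the current boundary data. [cite: SchrammSheffield2005, §3.1 (discrete harmonic extension; Lemma 1)] -/
def latticeFlowLineHarmonicCentredC (E : DiscreteDobrushin) (β : Site 2 → ℝ) (c g : ℝ) (h n : ℕ)
    (P : ℕ → HexVertex) (ζ : Site 2) : ℝ :=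
  triHitExtension (triDiscreteDomainGraph E.Ω E.δ) (flowLineAbsorbing E P n)
    (latticeFlowLineCentredDataC E β c g h n P) ζ

/-! ### API of the canonical window angle -/

section Angle

variable (β : Site 2 → ℝ) (P : ℕ → HexVertex)

/-- The chord of radius `0` is the dart itself: `θ_0(i) = arg (c_{i+1} − c_i)`. [folklore] -/
theorem centredChordArg_zero (i : ℕ) :
    centredChordArg P 0 i = Complex.arg (hexCenter (P (i + 1)) - hexCenter (P i)) := by
  simp [centredChordArg]

/-- **Radius `0`**: `Θ_0(i) = A_i`, the unwrapped dart angle. [folklore] -/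
@[simp] theorem centredWindowAngleC_zero (i : ℕ) : centredWindowAngleC β P 0 i = dartAngle β P i := by
  simp [centredWindowAngleC]

/-- **Radial recursion**: `Θ_{h+1}(i) = Θ_h(i) + pv (θ_{h+1}(i) − θ_h(i))`. [folklore] -/
theorem centredWindowAngleC_succ (h i : ℕ) :
    centredWindowAngleC β P (h + 1) i = centredWindowAngleC β P h i +
      ((centredChordArg P (h + 1) i - centredChordArg P h i : ℝ) : Real.Angle).toReal := by
  simp only [centredWindowAngleC, centredChordArg, Finset.sum_range_succ]
  rw [show i + 1 + (h + 1) = i + 2 + h by omega]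
  ring

/-- The canonical window angle moves by at most `π` per ring. [folklore] -/
theorem abs_centredWindowAngleC_succ_sub_le (h i : ℕ) :
    |centredWindowAngleC β P (h + 1) i - centredWindowAngleC β P h i| ≤ Real.pi := by
  rw [centredWindowAngleC_succ, add_sub_cancel_left]
  exact Real.Angle.abs_toReal_le_pi _

/-- `|Θ_h(i) − A_i| ≤ h π` (and no better in general: the relative winding of the window is
unbounded in `h`). [folklore] -/
theorem abs_centredWindowAngleC_sub_dartAngle_le (h i : ℕ) :
    |centredWindowAngleC β P h i - dartAngle β P i| ≤ h * Real.pi := by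
  rw [centredWindowAngleC, add_sub_cancel_left]
  calc |∑ m ∈ Finset.range h, (((Complex.arg (hexCenter (P (i + 2 + m)) - hexCenter (P (i - (m + 1)))) -
          Complex.arg (hexCenter (P (i + 1 + m)) - hexCenter (P (i - m))) : ℝ) : Real.Angle)).toReal|
      ≤ ∑ m ∈ Finset.range h, |(((Complex.arg (hexCenter (P (i + 2 + m)) - hexCenter (P (i - (m + 1)))) -
          Complex.arg (hexCenter (P (i + 1 + m)) - hexCenter (P (i - m))) : ℝ) : Real.Angle)).toReal| :=
        Finset.abs_sum_le_sum_abs _ _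
    _ ≤ ∑ _m ∈ Finset.range h, Real.pi := Finset.sum_le_sum fun m _ => Real.Angle.abs_toReal_le_pi _
    _ = h * Real.pi := by simp

/-- **Canonical sheet**: modulo `2π`, `Θ_h(i) ≡ A_i + θ_h(i) − θ_0(i)` — the sum of principal values
telescopes in `Real.Angle`, so `Θ_h(i)` is a lift of the chord direction `θ_h(i)` shifted by the
constant class `A_i − θ_0(i)` (which vanishes on honeycomb face paths, where `A_i` is a branch of
the dart direction). [folklore] -/
theorem coe_centredWindowAngleC (h i : ℕ) :
    (centredWindowAngleC β P h i : Real.Angle) =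
      (dartAngle β P i : Real.Angle) + (centredChordArg P h i : Real.Angle) -
        (centredChordArg P 0 i : Real.Angle) := by
  induction h with
  | zero => simp
  | succ h ih =>
    rw [centredWindowAngleC_succ, Real.Angle.coe_add, Real.Angle.coe_toReal, ih, Real.Angle.coe_sub]
    abel

/-- **The pv-lift is the continuous lift.** If `φ` is any real lift of the chord directions
(`φ m ≡ θ_m(i) (mod 2π)`) starting at the dart angle (`φ 0 = A_i`) whose increments over the first
`h` rings are `< π` in absolute value, then `Θ_h(i) = φ h`. (On a simple honeycomb face path the
true angle change of each radial increment is `< π`, so `Θ_h` is the continuous unwrapping of the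
chord direction started at `A_i`.) [folklore] -/
theorem centredWindowAngleC_eq_of_lift {i h : ℕ} (φ : ℕ → ℝ) (h0 : φ 0 = dartAngle β P i)
    (hφ : ∀ m ≤ h, (φ m : Real.Angle) = (centredChordArg P m i : Real.Angle))
    (hinc : ∀ m < h, |φ (m + 1) - φ m| < Real.pi) : centredWindowAngleC β P h i = φ h := by
  induction h with
  | zero => simpa using h0.symm
  | succ h ih =>
    have hprev : centredWindowAngleC β P h i = φ h :=
      ih (fun m hm => hφ m (Nat.le_succ_of_le hm)) fun m hm => hinc m (Nat.lt_succ_of_lt hm)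
    have hpv : ((centredChordArg P (h + 1) i - centredChordArg P h i : ℝ) : Real.Angle).toReal =
        φ (h + 1) - φ h := by
      rw [Real.Angle.coe_sub, ← hφ (h + 1) le_rfl, ← hφ h (Nat.le_succ h), ← Real.Angle.coe_sub,
        Real.Angle.toReal_coe_eq_self_iff]
      have hlt := hinc h (Nat.lt_succ_self h)
      exact ⟨(abs_lt.1 hlt).1, (abs_lt.1 hlt).2.le⟩
    rw [centredWindowAngleC_succ, hprev, hpv]
    ring

end Angle

/-! ### API of the canonical centred data and functional -/

section Centred

variable (E : DiscreteDobrushin) (β : Site 2 → ℝ) (c g : ℝ) (h : ℕ) (P : ℕ → HexVertex)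

/-- On the arcs the canonical centred data are the boundary data `β`. [folklore] -/
theorem latticeFlowLineCentredDataC_of_mem_arcs (n : ℕ) {u : Site 2} (hu : u ∈ E.triArcA ∪ E.triArcB) :
    latticeFlowLineCentredDataC E β c g h n P u = β u := by
  unfold latticeFlowLineCentredDataC; rw [if_pos hu]

/-- **Provisional data = first-passage data**: a hexagon whose forward half-window is not yet
explored at time `n` (`n ≤ firstPassage P u + h`) carries the first-passage datum of
`LatticeFlowLineHarmonic.lean`. [folklore] -/
theorem latticeFlowLineCentredDataC_of_le {n : ℕ} {u : Site 2} (hn : n ≤ firstPassage P u + h) :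
    latticeFlowLineCentredDataC E β c g h n P u = latticeFlowLineData E β c g P u := by
  unfold latticeFlowLineCentredDataC latticeFlowLineData
  rw [if_neg (not_lt.2 hn)]

open scoped Classical in
/-- **The canonical centred rule as a correction of the first-passage rule**: the data differ by
`c (Θ_h(i₀) − A_{i₀})/(π/3)` on the bank hexagons whose window is complete, and agree elsewhere.
[folklore] -/
theorem latticeFlowLineCentredDataC_sub (n : ℕ) (u : Site 2) :
    latticeFlowLineCentredDataC E β c g h n P u - latticeFlowLineData E β c g P u =
      if u ∈ E.triArcA ∪ E.triArcB then 0 else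
        if firstPassage P u + h < n then
          c * ((centredWindowAngleC β P h (firstPassage P u) - dartAngle β P (firstPassage P u)) /
            (Real.pi / 3))
        else 0 := by
  unfold latticeFlowLineCentredDataC latticeFlowLineData
  split_ifs <;> ring

/-- The window correction is bounded by `3 h |c|` (`|Θ_h − A| ≤ h π`). [folklore] -/
theorem abs_latticeFlowLineCentredDataC_sub_le (n : ℕ) (u : Site 2) :
    |latticeFlowLineCentredDataC E β c g h n P u - latticeFlowLineData E β c g P u| ≤ 3 * h * |c| := by
  rw [latticeFlowLineCentredDataC_sub]
  have h3 : 0 ≤ 3 * (h : ℝ) * |c| := by positivity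
  split_ifs with h1 h2
  · rw [abs_zero]; exact h3
  · rw [abs_mul, abs_div, abs_of_pos (by positivity : (0 : ℝ) < Real.pi / 3)]
    calc |c| * (|centredWindowAngleC β P h (firstPassage P u) - dartAngle β P (firstPassage P u)| /
          (Real.pi / 3))
        ≤ |c| * ((h * Real.pi) / (Real.pi / 3)) := by
          gcongr
          exact abs_centredWindowAngleC_sub_dartAngle_le β P h _
      _ = 3 * h * |c| := by
          field_simp
  · rw [abs_zero]; exact h3

/-- **Radius `0` = the first-passage rule**: with `h = 0` the canonical centred data ARE the
first-passage data (`Θ_0 = A`). [folklore] -/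
theorem latticeFlowLineCentredDataC_zero (n : ℕ) :
    latticeFlowLineCentredDataC E β c g 0 n P = latticeFlowLineData E β c g P := by
  funext u
  unfold latticeFlowLineCentredDataC latticeFlowLineData
  simp only [centredWindowAngleC_zero, ite_self]

/-- The canonical centred data are bounded on the absorbing set as soon as `β` is bounded on the
arcs (finitely many bank hexagons). [folklore] -/
theorem exists_abs_latticeFlowLineCentredDataC_le {B : ℝ}
    (hβ : ∀ u ∈ E.triArcA ∪ E.triArcB, |β u| ≤ B) (n : ℕ) :
    ∃ M, 0 ≤ M ∧ ∀ u ∈ flowLineAbsorbing E P n, |latticeFlowLineCentredDataC E β c g h n P u| ≤ M :=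
  exists_abs_le_on_union (passedHexagons_finite P n) fun u hu => by
    rw [latticeFlowLineCentredDataC_of_mem_arcs E β c g h P n hu]; exact hβ u hu

/-- **Boundary values**: on the absorbing set the functional is the datum. [folklore] -/
theorem latticeFlowLineHarmonicCentredC_of_mem {n : ℕ} {ζ : Site 2} (hζ : ζ ∈ flowLineAbsorbing E P n) :
    latticeFlowLineHarmonicCentredC E β c g h n P ζ = latticeFlowLineCentredDataC E β c g h n P ζ :=
  triHitExtension_of_mem _ hζ

/-- On the arcs the functional is `β`. [folklore] -/
theorem latticeFlowLineHarmonicCentredC_of_mem_arcs (n : ℕ) {ζ : Site 2}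
    (hζ : ζ ∈ E.triArcA ∪ E.triArcB) : latticeFlowLineHarmonicCentredC E β c g h n P ζ = β ζ := by
  rw [latticeFlowLineHarmonicCentredC_of_mem E β c g h P (subset_flowLineAbsorbing E P n hζ),
    latticeFlowLineCentredDataC_of_mem_arcs E β c g h P n hζ]

/-- **Harmonicity off the absorbing set** (the first-step identity in `ζ`): for `ζ` not on an arc
and not yet passed, the functional is the six-neighbour `Ω_δ`-mean of itself, for `β` bounded on the
arcs. [cite: SchrammSheffield2005, §3.1 (discrete harmonic extension; Lemma 1)] -/
theorem latticeFlowLineHarmonicCentredC_of_not_mem {B : ℝ}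
    (hβ : ∀ u ∈ E.triArcA ∪ E.triArcB, |β u| ≤ B) {n : ℕ} {ζ : Site 2}
    (hζ : ζ ∉ flowLineAbsorbing E P n) :
    latticeFlowLineHarmonicCentredC E β c g h n P ζ =
      triSubgraphMean (triDiscreteDomainGraph E.Ω E.δ) (latticeFlowLineHarmonicCentredC E β c g h n P) ζ := by
  obtain ⟨M, -, hM⟩ := exists_abs_latticeFlowLineCentredDataC_le E β c g h P hβ n
  exact triHitExtension_of_not_mem (triDiscreteDomainGraph_le_triGraph E.Ω E.δ) hM hζ

/-- **The canonical centred functional solves the Dirichlet problem** with the canonical centred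
data on the absorbing set (harmonic at the undetermined hexagons), for `β` bounded on the arcs.
[cite: SchrammSheffield2005, §3.1 (discrete harmonic extension; Lemma 1)] -/
theorem isTriHarmonicExtension_latticeFlowLineHarmonicCentredC {B : ℝ}
    (hβ : ∀ u ∈ E.triArcA ∪ E.triArcB, |β u| ≤ B) (n : ℕ) :
    IsTriHarmonicExtension (triDiscreteDomainGraph E.Ω E.δ) (flowLineAbsorbing E P n)ᶜ
      (latticeFlowLineCentredDataC E β c g h n P) (latticeFlowLineHarmonicCentredC E β c g h n P) := by
  obtain ⟨M, -, hM⟩ := exists_abs_latticeFlowLineCentredDataC_le E β c g h P hβ n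
  exact isTriHarmonicExtension_triHitExtension (triDiscreteDomainGraph_le_triGraph E.Ω E.δ) hM

/-- **Boundedness by `max |data|`**. [folklore] -/
theorem abs_latticeFlowLineHarmonicCentredC_le {n : ℕ} {M : ℝ} (hM0 : 0 ≤ M)
    (hM : ∀ u ∈ flowLineAbsorbing E P n, |latticeFlowLineCentredDataC E β c g h n P u| ≤ M)
    (ζ : Site 2) : |latticeFlowLineHarmonicCentredC E β c g h n P ζ| ≤ M :=
  abs_triHitExtension_le (triDiscreteDomainGraph_le_triGraph E.Ω E.δ) hM0 hM ζ

/-- **Radius `0` = the first-passage functional** of `LatticeFlowLineHarmonic.lean`. [folklore] -/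
theorem latticeFlowLineHarmonicCentredC_zero (n : ℕ) (ζ : Site 2) :
    latticeFlowLineHarmonicCentredC E β c g 0 n P ζ = latticeFlowLineHarmonic E β c g n P ζ := by
  rw [latticeFlowLineHarmonicCentredC, latticeFlowLineCentredDataC_zero, latticeFlowLineHarmonic]

open scoped Classical in
/-- **Canonical centred minus first-passage functional = absorbed extension of the window
correction** `c (Θ_h(i₀) − A_{i₀})/(π/3)` (zero on the arcs and on the hexagons with an incomplete
window), for `β` bounded on the arcs. [folklore] -/
theorem latticeFlowLineHarmonicCentredC_sub {B : ℝ} (hβ : ∀ u ∈ E.triArcA ∪ E.triArcB, |β u| ≤ B)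
    (n : ℕ) (ζ : Site 2) :
    latticeFlowLineHarmonicCentredC E β c g h n P ζ - latticeFlowLineHarmonic E β c g n P ζ =
      triHitExtension (triDiscreteDomainGraph E.Ω E.δ) (flowLineAbsorbing E P n)
        (fun u => if u ∈ E.triArcA ∪ E.triArcB then 0 else
          if firstPassage P u + h < n then
            c * ((centredWindowAngleC β P h (firstPassage P u) - dartAngle β P (firstPassage P u)) /
              (Real.pi / 3))
          else 0) ζ := by
  obtain ⟨M₁, -, h₁⟩ := exists_abs_latticeFlowLineCentredDataC_le E β c g h P hβ n
  obtain ⟨M₂, -, h₂⟩ := exists_abs_latticeFlowLineData_le E β c g P hβ n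
  unfold latticeFlowLineHarmonicCentredC latticeFlowLineHarmonic
  rw [triHitExtension_sub (triDiscreteDomainGraph_le_triGraph E.Ω E.δ) h₁ h₂]
  refine congrArg (fun d => triHitExtension _ _ d ζ) (funext fun u => ?_)
  exact latticeFlowLineCentredDataC_sub E β c g h P n u

/-- The absorbed window correction is bounded by `3 h |c|` everywhere. [folklore] -/
theorem abs_latticeFlowLineHarmonicCentredC_sub_le {B : ℝ}
    (hβ : ∀ u ∈ E.triArcA ∪ E.triArcB, |β u| ≤ B) (n : ℕ) (ζ : Site 2) :
    |latticeFlowLineHarmonicCentredC E β c g h n P ζ - latticeFlowLineHarmonic E β c g n P ζ| ≤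
      3 * h * |c| := by
  obtain ⟨M₁, -, h₁⟩ := exists_abs_latticeFlowLineCentredDataC_le E β c g h P hβ n
  obtain ⟨M₂, -, h₂⟩ := exists_abs_latticeFlowLineData_le E β c g P hβ n
  unfold latticeFlowLineHarmonicCentredC latticeFlowLineHarmonic
  rw [triHitExtension_sub (triDiscreteDomainGraph_le_triGraph E.Ω E.δ) h₁ h₂]
  exact abs_triHitExtension_le (triDiscreteDomainGraph_le_triGraph E.Ω E.δ) (by positivity)
    (fun u _ => abs_latticeFlowLineCentredDataC_sub_le E β c g h P n u) ζ

end Centred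

/-! ### Adaptedness: at time `n` the data and the functional only read `P 0, …, P n` -/

section Adapted

variable (E : DiscreteDobrushin) (β : Site 2 → ℝ) (c g : ℝ) (h : ℕ) {P P' : ℕ → HexVertex} {n : ℕ}

/-- The hexagons passed by the darts `< n` only depend on the faces `P 0, …, P n`. [folklore] -/
theorem passedHexagons_congr (hP : ∀ i ≤ n, P' i = P i) : passedHexagons P' n = passedHexagons P n := by
  ext u
  simp only [passedHexagons, Set.mem_setOf_eq]
  refine exists_congr fun i => and_congr_right fun hi => ?_
  rw [hP i hi.le, hP (i + 1) (Nat.succ_le_of_lt hi)]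

/-- The absorbing set at time `n` only depends on `P 0, …, P n`. [folklore] -/
theorem flowLineAbsorbing_congr (hP : ∀ i ≤ n, P' i = P i) :
    flowLineAbsorbing E P' n = flowLineAbsorbing E P n := by
  rw [flowLineAbsorbing, flowLineAbsorbing, passedHexagons_congr hP]

/-- The first passing dart of a hexagon passed before time `n` only depends on `P 0, …, P n`.
[folklore] -/
theorem firstPassage_congr (hP : ∀ i ≤ n, P' i = P i) {u : Site 2} (hu : u ∈ passedHexagons P n) :
    firstPassage P' u = firstPassage P u := by
  have key : ∀ {Q Q' : ℕ → HexVertex}, (∀ i ≤ n, Q' i = Q i) → u ∈ passedHexagons Q n →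
      firstPassage Q' u ≤ firstPassage Q u := by
    intro Q Q' hQ huQ
    obtain ⟨hlt, h1, h2⟩ := firstPassage_spec Q huQ
    refine firstPassage_le Q' ⟨?_, ?_⟩
    · rwa [hQ _ hlt.le]
    · rwa [hQ _ (Nat.succ_le_of_lt hlt)]
  have hu' : u ∈ passedHexagons P' n := by rwa [passedHexagons_congr hP]
  exact le_antisymm (key hP hu) (key (fun i hi => (hP i hi).symm) hu')

/-- The turn at face `j` only reads `P (j - 1), P j, P (j + 1)`. [folklore] -/
theorem hexPathTurn_congr (hP : ∀ i ≤ n, P' i = P i) {j : ℕ} (hj : j + 1 ≤ n) :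
    hexPathTurn P' j = hexPathTurn P j := by
  simp only [hexPathTurn, hP j (by omega), hP (j + 1) hj, hP (j - 1) (by omega)]

/-- The dart angle `A_i` only reads `P 0, …, P (i + 1)`. [folklore] -/
theorem dartAngle_congr (hP : ∀ i ≤ n, P' i = P i) {i : ℕ} (hi : i + 1 ≤ n) :
    dartAngle β P' i = dartAngle β P i := by
  simp only [dartAngle, hP 0 (by omega), hP 1 (by omega)]
  refine congrArg (fun s => tiltedExplorerInitAngle β (P 0) (P 1) + Real.pi / 3 * s)
    (Finset.sum_congr rfl fun j hj => hexPathTurn_congr hP ?_)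
  rw [Finset.mem_Icc] at hj
  omega

/-- The side of a dart only reads its two faces. [folklore] -/
theorem isLeftOfDart_congr (hP : ∀ i ≤ n, P' i = P i) {i : ℕ} (hi : i + 1 ≤ n) (u : Site 2) :
    IsLeftOfDart P' i u ↔ IsLeftOfDart P i u := by
  simp only [IsLeftOfDart, hP i (by omega), hP (i + 1) hi]

/-- The canonical window angle `Θ_h(i)` only reads `P 0, …, P (i + 1 + h)`. [folklore] -/
theorem centredWindowAngleC_congr (hP : ∀ i ≤ n, P' i = P i) {i : ℕ} (hi : i + 1 + h ≤ n) :
    centredWindowAngleC β P' h i = centredWindowAngleC β P h i := by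
  unfold centredWindowAngleC
  rw [dartAngle_congr β hP (by omega)]
  refine congrArg _ (Finset.sum_congr rfl fun m hm => ?_)
  rw [Finset.mem_range] at hm
  rw [hP (i + 2 + m) (by omega), hP (i - (m + 1)) (by omega), hP (i + 1 + m) (by omega),
    hP (i - m) (by omega)]

open scoped Classical in
/-- **Adaptedness of the data**: on the absorbing set, the canonical centred data at time `n` only
read the faces `P 0, …, P n` (the complete-window branch is used only when `i₀ + h < n`). [folklore] -/
theorem latticeFlowLineCentredDataC_congr (hP : ∀ i ≤ n, P' i = P i) {u : Site 2}
    (hu : u ∈ flowLineAbsorbing E P n) :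
    latticeFlowLineCentredDataC E β c g h n P' u = latticeFlowLineCentredDataC E β c g h n P u := by
  by_cases harc : u ∈ E.triArcA ∪ E.triArcB
  · rw [latticeFlowLineCentredDataC_of_mem_arcs E β c g h P' n harc,
      latticeFlowLineCentredDataC_of_mem_arcs E β c g h P n harc]
  · have hu' : u ∈ passedHexagons P n := ((Set.mem_union _ _ _).1 hu).resolve_left harc
    obtain ⟨hlt, -, -⟩ := firstPassage_spec P hu'
    have hfp : firstPassage P' u = firstPassage P u := firstPassage_congr hP hu'
    have hW : (if firstPassage P u + h < n then centredWindowAngleC β P' h (firstPassage P u)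
          else dartAngle β P' (firstPassage P u)) =
        (if firstPassage P u + h < n then centredWindowAngleC β P h (firstPassage P u)
          else dartAngle β P (firstPassage P u)) := by
      split_ifs with hcond
      · exact centredWindowAngleC_congr β h hP (by omega)
      · exact dartAngle_congr β hP (Nat.succ_le_of_lt hlt)
    have hL : (if IsLeftOfDart P' (firstPassage P u) u then -g else g) =
        (if IsLeftOfDart P (firstPassage P u) u then -g else g) :=
      if_congr (isLeftOfDart_congr hP (Nat.succ_le_of_lt hlt) u) rfl rfl
    unfold latticeFlowLineCentredDataC
    rw [if_neg harc, if_neg harc, hfp, hW, hL]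

/-- **Adaptedness of the functional**: `Ĥ^C_n(P)(ζ)` only reads the faces `P 0, …, P n`. [folklore] -/
theorem latticeFlowLineHarmonicCentredC_congr (hP : ∀ i ≤ n, P' i = P i) (ζ : Site 2) :
    latticeFlowLineHarmonicCentredC E β c g h n P' ζ = latticeFlowLineHarmonicCentredC E β c g h n P ζ := by
  unfold latticeFlowLineHarmonicCentredC triHitExtension
  rw [flowLineAbsorbing_congr E hP]
  refine tsum_congr fun u => ?_
  by_cases hu : u ∈ flowLineAbsorbing E P n
  · rw [latticeFlowLineCentredDataC_congr E β c g h hP hu]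
  · rw [triHitKernel_of_not_mem_target hu, zero_mul, zero_mul]

/-- **The functional stopped at a prefix stopping rule is `𝓕_σ`-measurable** (Galmarino's form,
`IsPrefixDetermined` of `LatticeFlowLinePassage.lean`). [folklore] -/
theorem isPrefixDetermined_latticeFlowLineHarmonicCentredC (ζ : Site 2) {σ : (ℕ → HexVertex) → ℕ}
    (hσ : IsPrefixStopping σ) :
    IsPrefixDetermined σ fun Q => latticeFlowLineHarmonicCentredC E β c g h (σ Q) Q ζ := by
  intro Q Q' hQ
  dsimp only
  rw [hσ Q Q' hQ]
  exact latticeFlowLineHarmonicCentredC_congr E β c g h hQ ζ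

end Adapted

end Literature.Probability.RandomPlanarGeometry

end
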